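import Mathlib
import HarnessLib
import Summits.CriticalPhenomena.CardyFormulaZ2.Theses.CardySelfDualSegment
import Literature.Probability.Percolation.CornerPercolation
import Literature.Barriers.CriticalPhenomena.EmbeddingModulusUniquenessProofs
import Literature.Probability.RandomPlanarGeometry.ConformalRectangleProofs
import Literature.Probability.RandomPlanarGeometry.CardyFunction
import Literature.Probability.RandomPlanarGeometry.DiamondShearChart
import Summits.CriticalPhenomena.CardyFormulaZ2.Theorems.SegmentOpen.Negative.NormOne
import Summits.CriticalPhenomena.CardyFormulaZ2.Theorems.CardySelfDualSegmentSegmentOpenStubCrossingProbPolynomial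
import Summits.CriticalPhenomena.CardyFormulaZ2.Theorems.CardySelfDualSegmentSegmentOpenStubVitaliJets
import Summits.CriticalPhenomena.CardyFormulaZ2.Theorems.CardySelfDualSegmentSegmentOpenStubGoodSetNhdsZeroOfJets
import Summits.CriticalPhenomena.CardyFormulaZ2.Theorems.CardySelfDualSegmentSegmentOpenStubGoodSetUnivOfGlobalJets
import Summits.CriticalPhenomena.CardyFormulaZ2.Theorems.CardySelfDualSegmentSegmentOpenJetConvOfLimits
import Summits.CriticalPhenomena.CardyFormulaZ2.Theorems.CardySelfDualSegmentSegmentOpenSmirnovGermForm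
import Summits.CriticalPhenomena.CardyFormulaZ2.Theorems.CardyQContinuationJetLimitLemma
import Summits.CriticalPhenomena.CardyFormulaZ2.Theorems.CardySelfDualSegmentSegmentOpenGlobalJetsCurve

/-!
# Crux `SegmentOpen` (stmt-CriticalPhenomena-5471), line `Sketch` — census lemmas: analytic limits along the segment and analytic chart inversion

Lead c5, reshape 7 (GLOBAL JETS); part 1 of "under S4w, the Target gives JI" (part 2:
`CardySelfDualSegmentSegmentOpenJetIdentificationOfTarget.lean`).  Four analytic lemmas over
abstract data (no percolation content is claimed):

* `exists_cover` — pointwise-in-`t₀` bounds for a family of complex polynomials near every point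
  of `[0,1]` give ONE open preconnected complex neighbourhood of the segment with a common bound
  (compactness);
* `exists_limit_on` — Vitali with jets (landed VJ `stub_vitaliJets`, p132875) along one sequence of
  meshes on that neighbourhood;
* `exists_analytic_limit` (registered helper) — if moreover all coefficients converge, the real
  evaluations converge, at every `t ∈ [0,1]`, to ONE real-analytic function on `[0,1]` (the limit
  does not depend on the sequence of meshes: jet form of the identity theorem,
  `JetLimit.eqOn_of_forall_iteratedDeriv_eq`);
* `exists_analytic_chart_inverse` — a real-analytic `Φ` on `[0,1]` taking the values `c (σ t)` of
  a strictly decreasing analytic chart `c` with `c′ ≠ 0` is `c ∘ S` for a real-analytic `S`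
  extending `σ` (analytic inverse function theorem, `AnalyticAt.analyticAt_localInverse`, +
  injectivity of `c`).
-/

noncomputable section

namespace Summit.CriticalPhenomena.CardyFormulaZ2.Theorems

open Literature.Probability Literature.Barriers.CriticalPhenomena
open Literature.Probability.RandomPlanarGeometry (ConformalRectangle ConformalEquiv MarkedDomain)
open Filter Set Topology MeasureTheory
open UpperHalfPlane (upperHalfPlaneSet)

namespace JetIdentificationOfTarget

open GoodSetUnivOfGlobalJets JetConvOfLimits

/-- **Cover lemma.**  Pointwise-in-`t₀` bounds for the complex polynomials `P δ` near every point
of the segment give ONE open preconnected complex neighbourhood `U` of the segment with a common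
mesh threshold and a common bound (compactness of `[0,1]`). -/
theorem exists_cover {P : ℝ → Polynomial ℝ}
    (hB : ∀ t₀ : unitInterval, ∃ r > 0, ∃ δ₁ > 0, ∃ C : ℝ, ∀ δ : ℝ, 0 < δ → δ < δ₁ →
      ∀ z ∈ Metric.ball ((t₀ : ℝ) : ℂ) r, ‖((P δ).map (algebraMap ℝ ℂ)).eval z‖ ≤ C) :
    ∃ U : Set ℂ, IsOpen U ∧ IsPreconnected U ∧ (∀ s : unitInterval, ((s : ℝ) : ℂ) ∈ U) ∧
      ∃ δm > 0, ∃ Cm : ℝ, ∀ δ : ℝ, 0 < δ → δ < δm →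
        ∀ z ∈ U, ‖((P δ).map (algebraMap ℝ ℂ)).eval z‖ ≤ Cm := by
  classical
  choose r hr δ₁ hδ₁ C hC using hB
  set V : unitInterval → Set unitInterval := fun i =>
    {s : unitInterval | ((s : ℝ) : ℂ) ∈ Metric.ball ((i : ℝ) : ℂ) (r i)} with hV
  have hVo : ∀ i, IsOpen (V i) := fun i => Metric.isOpen_ball.preimage continuous_coeC
  have hVcov : (univ : Set unitInterval) ⊆ ⋃ i, V i := fun s _ =>
    mem_iUnion.2 ⟨s, Metric.mem_ball_self (hr s)⟩
  obtain ⟨T, hT⟩ := isCompact_univ.elim_finite_subcover V hVo hVcov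
  have hTne : T.Nonempty := by
    obtain ⟨i, hi, -⟩ := mem_iUnion₂.1 (hT (mem_univ 0))
    exact ⟨i, hi⟩
  set δm : ℝ := T.inf' hTne δ₁ with hδm
  have hδm0 : 0 < δm := (Finset.lt_inf'_iff hTne).2 fun i _ => hδ₁ i
  have hδmle : ∀ i ∈ T, δm ≤ δ₁ i := fun i hi => Finset.inf'_le _ hi
  set Cm : ℝ := T.sup' hTne C with hCm
  have hCmle : ∀ i ∈ T, C i ≤ Cm := fun i hi => Finset.le_sup' _ hi
  set U : Set ℂ := ⋃ i ∈ T, Metric.ball (((i : unitInterval) : ℝ) : ℂ) (r i) with hU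
  have hUo : IsOpen U := isOpen_biUnion fun i _ => Metric.isOpen_ball
  set seg : Set ℂ := range fun s : unitInterval => ((s : ℝ) : ℂ) with hseg
  have hsegU : seg ⊆ U := by
    rintro _ ⟨s, rfl⟩
    obtain ⟨i, hi, hs⟩ := mem_iUnion₂.1 (hT (mem_univ s))
    exact mem_iUnion₂.2 ⟨i, hi, hs⟩
  have hmemU : ∀ s : unitInterval, ((s : ℝ) : ℂ) ∈ U := fun s => hsegU ⟨s, rfl⟩
  have hUc : IsPreconnected U := by
    have hU' : U = ⋃ i ∈ T, (Metric.ball (((i : unitInterval) : ℝ) : ℂ) (r i) ∪ seg) := by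
      apply Subset.antisymm
      · exact iUnion₂_mono fun i _ => subset_union_left
      · refine iUnion₂_subset fun i hi => union_subset ?_ hsegU
        exact subset_iUnion₂ (s := fun i _ => Metric.ball (((i : unitInterval) : ℝ) : ℂ) (r i)) i hi
    rw [hU', ← Finset.set_biUnion_coe, ← sUnion_image]
    refine isPreconnected_sUnion ((((0 : unitInterval) : ℝ) : ℂ)) _ ?_ ?_
    · rintro _ ⟨i, -, rfl⟩
      exact Or.inr ⟨0, rfl⟩
    · rintro _ ⟨i, -, rfl⟩
      exact IsPreconnected.union (((i : unitInterval) : ℝ) : ℂ) (Metric.mem_ball_self (hr i))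
        ⟨i, rfl⟩ (convex_ball _ _).isPreconnected isPreconnected_seg
  refine ⟨U, hUo, hUc, hmemU, δm, hδm0, max Cm 0, fun δ hδ hδ' z hz => ?_⟩
  obtain ⟨j, hj, hzj⟩ := mem_iUnion₂.1 hz
  exact ((hC j δ hδ (hδ'.trans_le (hδmle j hj)) z hzj).trans (hCmle j hj)).trans (le_max_left _ _)

/-- **Vitali with jets along one sequence of meshes on the neighbourhood `U`.**  The complex
crossing polynomials converge locally uniformly on `U` to a holomorphic `g` whose jets at `0` are
`k! · a k` (the coefficient limits), and the real evaluations converge to `re ∘ g` on the real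
points of `U`. -/
theorem exists_limit_on {P : ℝ → Polynomial ℝ} {U : Set ℂ} (hUo : IsOpen U)
    (hUc : IsPreconnected U) (h0U : (0 : ℂ) ∈ U) {δm Cm : ℝ} (hδm : 0 < δm)
    (hCm : ∀ δ : ℝ, 0 < δ → δ < δm → ∀ z ∈ U, ‖((P δ).map (algebraMap ℝ ℂ)).eval z‖ ≤ Cm)
    {a : ℕ → ℝ}
    (ha : ∀ k : ℕ, ∀ ε > 0, ∃ δ₀ > 0, ∀ δ : ℝ, 0 < δ → δ < δ₀ → |(P δ).coeff k - a k| < ε)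
    {d : ℕ → ℝ} (hd : Tendsto d atTop (𝓝[>] 0)) :
    ∃ g : ℂ → ℂ, DifferentiableOn ℂ g U ∧
      (∀ k : ℕ, iteratedDeriv k g 0 = (k.factorial : ℂ) * ((a k : ℝ) : ℂ)) ∧
      ∀ s : ℝ, (s : ℂ) ∈ U → Tendsto (fun n => (P (d n)).eval s) atTop (𝓝 (g s).re) := by
  classical
  have hgood : ∀ᶠ n in atTop, 0 < d n ∧ d n < δm := by
    have h1 : ∀ᶠ n in atTop, d n ∈ Ioo 0 δm := hd (Ioo_mem_nhdsGT hδm)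
    exact h1.mono fun n hn => hn
  set F : ℕ → ℂ → ℂ := fun n =>
    if 0 < d n ∧ d n < δm then fun z => ((P (d n)).map (algebraMap ℝ ℂ)).eval z else 0 with hF
  have hFgood : ∀ n, 0 < d n ∧ d n < δm →
      F n = fun z => ((P (d n)).map (algebraMap ℝ ℂ)).eval z := fun n hn => by
    simp only [hF, if_pos hn]
  have hFbad : ∀ n, ¬ (0 < d n ∧ d n < δm) → F n = 0 := fun n hn => by
    simp only [hF, if_neg hn]
  have hFd : ∀ n, DifferentiableOn ℂ (F n) U := fun n => by
    by_cases hn : 0 < d n ∧ d n < δm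
    · rw [hFgood n hn]
      exact (Polynomial.differentiable _).differentiableOn
    · rw [hFbad n hn]
      exact differentiableOn_const 0
  have hFb : ∀ w ∈ U, ∃ M : ℝ, ∃ ρ > 0, ∀ n, ∀ z ∈ Metric.ball w ρ ∩ U, ‖F n z‖ ≤ M := by
    intro w _
    refine ⟨max Cm 0, 1, one_pos, fun n z hz => ?_⟩
    by_cases hn : 0 < d n ∧ d n < δm
    · rw [hFgood n hn]
      exact (hCm (d n) hn.1 hn.2 z hz.2).trans (le_max_left _ _)
    · rw [hFbad n hn]
      simp
  have hcoeff : ∀ k : ℕ, Tendsto (fun n => (P (d n)).coeff k) atTop (𝓝 (a k)) := by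
    intro k
    rw [Metric.tendsto_nhds]
    intro e he
    obtain ⟨δ₀, hδ₀, hδ⟩ := ha k e he
    have h1 : ∀ᶠ n in atTop, d n ∈ Ioo 0 δ₀ := hd (Ioo_mem_nhdsGT hδ₀)
    exact h1.mono fun n hn => hδ (d n) hn.1 hn.2
  have hjet : ∀ k : ℕ, Tendsto (fun n => iteratedDeriv k (F n) 0) atTop
      (𝓝 ((k.factorial : ℂ) * ((a k : ℝ) : ℂ))) := by
    intro k
    have h1 : Tendsto (fun n => (k.factorial : ℂ) * (((P (d n)).coeff k : ℝ) : ℂ)) atTop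
        (𝓝 ((k.factorial : ℂ) * ((a k : ℝ) : ℂ))) :=
      ((Complex.continuous_ofReal.tendsto (a k)).comp (hcoeff k)).const_mul _
    refine h1.congr' ?_
    filter_upwards [hgood] with n hn
    rw [hFgood n hn, GoodSetNhdsZeroOfJets.iteratedDeriv_map_eval_zero]
  obtain ⟨g, hgd, hgF, hgjet⟩ := stub_vitaliJets U hUo hUc 0 h0U F _ hFd hFb hjet
  refine ⟨g, hgd, hgjet, fun s hs => ?_⟩
  have hpt : Tendsto (fun n => F n (s : ℂ)) atTop (𝓝 (g (s : ℂ))) := hgF.tendsto_at hs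
  have hre := (Complex.continuous_re.tendsto _).comp hpt
  refine hre.congr' ?_
  filter_upwards [hgood] with n hn
  simp only [Function.comp_apply]
  rw [hFgood n hn]
  change (((P (d n)).map (algebraMap ℝ ℂ)).eval (algebraMap ℝ ℂ s)).re = _
  rw [Polynomial.eval_map, Polynomial.eval₂_at_apply]
  rfl

/-- **An analytic limit function on the segment.**  Under the pointwise bounds and the
convergence of all coefficients, the real evaluations `(P δ).eval t` converge as `δ → 0⁺`, for
every `t ∈ [0,1]`, to the values of ONE real-analytic function `Φ` on `[0,1]`. -/
theorem exists_analytic_limit :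
    ∀ {P : ℝ → Polynomial ℝ},
      (∀ t₀ : unitInterval, ∃ r > 0, ∃ δ₁ > 0, ∃ C : ℝ, ∀ δ : ℝ, 0 < δ → δ < δ₁ →
        ∀ z ∈ Metric.ball ((t₀ : ℝ) : ℂ) r, ‖((P δ).map (algebraMap ℝ ℂ)).eval z‖ ≤ C) →
      ∀ {a : ℕ → ℝ},
        (∀ k : ℕ, ∀ ε > 0, ∃ δ₀ > 0, ∀ δ : ℝ, 0 < δ → δ < δ₀ → |(P δ).coeff k - a k| < ε) →
        ∃ Φ : ℝ → ℝ, AnalyticOnNhd ℝ Φ (Set.Icc 0 1) ∧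
          ∀ t : unitInterval, Tendsto (fun δ => (P δ).eval (t : ℝ)) (𝓝[>] 0) (𝓝 (Φ t)) := by
  intro P hB a ha
  obtain ⟨U, hUo, hUc, hmemU, δm, hδm, Cm, hCm⟩ := exists_cover hB
  have h0U : (0 : ℂ) ∈ U := by simpa using hmemU 0
  -- the reference sequence of meshes and its limit
  have hd0 : Tendsto (fun n : ℕ => (1 : ℝ) / ((n : ℝ) + 2)) atTop (𝓝[>] 0) := by
    refine tendsto_nhdsWithin_iff.2 ⟨?_, Eventually.of_forall fun n => ?_⟩
    · have h1 : Tendsto (fun n : ℕ => (n : ℝ) + 2) atTop atTop :=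
        tendsto_natCast_atTop_atTop.atTop_add tendsto_const_nhds
      exact h1.const_div_atTop 1
    · show (1 : ℝ) / ((n : ℝ) + 2) ∈ Ioi 0
      exact mem_Ioi.2 (by positivity)
  obtain ⟨g₀, hg₀d, hg₀jet, -⟩ := exists_limit_on hUo hUc h0U hδm hCm ha hd0
  refine ⟨fun s => (g₀ (s : ℂ)).re, fun s hs => ?_, fun t => ?_⟩
  · have hsU : ((s : ℝ) : ℂ) ∈ U := hmemU ⟨s, hs⟩
    have hga : AnalyticAt ℂ g₀ (s : ℂ) := (hg₀d.analyticOnNhd hUo) _ hsU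
    have h1 : AnalyticAt ℝ (fun s : ℝ => g₀ (s : ℂ)) s :=
      (hga.restrictScalars (𝕜 := ℝ)).comp_of_eq (Complex.ofRealCLM.analyticAt s) rfl
    exact (Complex.reCLM.analyticAt _).comp h1
  · rw [tendsto_iff_seq_tendsto]
    intro d hd
    obtain ⟨g, hgd, hgjet, hglim⟩ := exists_limit_on hUo hUc h0U hδm hCm ha hd
    have hEq : EqOn g g₀ U :=
      JetLimit.eqOn_of_forall_iteratedDeriv_eq hUo hUc hgd hg₀d h0U fun k => by
        rw [hgjet k, hg₀jet k]
    have h := hglim (t : ℝ) (hmemU t)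
    rw [hEq (hmemU t)] at h
    exact h

/-- **Analytic inversion of a strictly monotone analytic chart along the segment.**  If `Φ` is
real-analytic on `[0,1]` and takes there the values `c (σ t)` of a strictly decreasing analytic
chart `c` on `(0, ∞)` with non-vanishing derivative at positive parameters `σ t`, then `σ` is the
restriction of a function `S` real-analytic on `[0,1]` (locally `S = c⁻¹ ∘ Φ` by the analytic
inverse function theorem; globally by injectivity of `c`). -/
theorem exists_analytic_chart_inverse {c : ℝ → ℝ} (hc_anti : StrictAntiOn c (Ioi 0))
    (hc_an : ∀ s, 0 < s → AnalyticAt ℝ c s) (hc_der : ∀ s, 0 < s → deriv c s ≠ 0)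
    {Φ : ℝ → ℝ} (hΦ : AnalyticOnNhd ℝ Φ (Icc 0 1)) {σ : unitInterval → ℝ} (hσ : ∀ t, 0 < σ t)
    (hΦσ : ∀ t : unitInterval, Φ t = c (σ t)) :
    ∃ S : ℝ → ℝ, AnalyticOnNhd ℝ S (Icc 0 1) ∧ ∀ t : unitInterval, S t = σ t := by
  classical
  have hinj : InjOn c (Ioi 0) := hc_anti.injOn
  set S : ℝ → ℝ := fun y => Function.invFunOn c (Ioi 0) (Φ y) with hSdef
  -- `S` inverts `c` wherever `Φ` takes a value of `c` on `(0, ∞)`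
  have hSspec : ∀ y : ℝ, (∃ s ∈ Ioi (0 : ℝ), c s = Φ y) → S y ∈ Ioi 0 ∧ c (S y) = Φ y :=
    fun y hy => Function.invFunOn_pos hy
  have hSt : ∀ t : unitInterval, S t = σ t := fun t => by
    obtain ⟨hmem, hval⟩ := hSspec t ⟨σ t, hσ t, (hΦσ t).symm⟩
    exact hinj hmem (hσ t) (hval.trans (hΦσ t))
  refine ⟨S, fun t₀ ht₀ => ?_, hSt⟩
  -- local analytic inverse of `c` at `a = σ t₀`
  set a : ℝ := σ ⟨t₀, ht₀⟩ with hadef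
  have ha : 0 < a := hσ _
  have hca : c a = Φ t₀ := (hΦσ ⟨t₀, ht₀⟩).symm
  have hstrict : HasStrictDerivAt c (deriv c a) a := (hc_an a ha).hasStrictDerivAt
  set L : ℝ → ℝ := hstrict.localInverse c (deriv c a) a (hc_der a ha) with hLdef
  have hLan : AnalyticAt ℝ L (c a) := (hc_an a ha).analyticAt_localInverse (hc_der a ha)
  have hLa : L (c a) = a := HasStrictFDerivAt.localInverse_apply_image ..
  have hright : ∀ᶠ y in 𝓝 (c a), c (L y) = y := HasStrictDerivAt.eventually_right_inverse ..
  have hLpos : ∀ᶠ y in 𝓝 (c a), 0 < L y := by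
    have : Tendsto L (𝓝 (c a)) (𝓝 (L (c a))) := hLan.continuousAt.tendsto
    rw [hLa] at this
    exact this.eventually (lt_mem_nhds ha)
  -- `Φ y → c a` as `y → t₀`, so eventually `S y = L (Φ y)`
  have hΦc : Tendsto Φ (𝓝 t₀) (𝓝 (c a)) := by
    rw [hca]; exact (hΦ t₀ ht₀).continuousAt.tendsto
  have hev : ∀ᶠ y in 𝓝 t₀, S y = L (Φ y) := by
    filter_upwards [hΦc.eventually hright, hΦc.eventually hLpos] with y hy hpos
    obtain ⟨hmem, hval⟩ := hSspec y ⟨L (Φ y), hpos, hy⟩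
    exact hinj hmem hpos (hval.trans hy.symm)
  have hcomp : AnalyticAt ℝ (fun y => L (Φ y)) t₀ := hLan.comp_of_eq (hΦ t₀ ht₀) hca.symm
  exact hcomp.congr (hev.mono fun y hy => hy.symm)

end JetIdentificationOfTarget

/-- **Analytic limit function along the segment** (registered helper; top-level restatement of
`JetIdentificationOfTarget.exists_analytic_limit`): pointwise-in-`t₀` uniform bounds for a family of
complex polynomials near every point of `[0,1]` plus convergence of all coefficients as `δ → 0⁺`
give ONE real-analytic function on `[0,1]` to whose values the real evaluations converge. -/
theorem exists_analytic_limit_of_coeff_tendsto :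
    ∀ {P : ℝ → Polynomial ℝ},
      (∀ t₀ : unitInterval, ∃ r > 0, ∃ δ₁ > 0, ∃ C : ℝ, ∀ δ : ℝ, 0 < δ → δ < δ₁ →
        ∀ z ∈ Metric.ball ((t₀ : ℝ) : ℂ) r, ‖((P δ).map (algebraMap ℝ ℂ)).eval z‖ ≤ C) →
      ∀ {a : ℕ → ℝ},
        (∀ k : ℕ, ∀ ε > 0, ∃ δ₀ > 0, ∀ δ : ℝ, 0 < δ → δ < δ₀ → |(P δ).coeff k - a k| < ε) →
        ∃ Φ : ℝ → ℝ, AnalyticOnNhd ℝ Φ (Set.Icc 0 1) ∧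
          ∀ t : unitInterval, Tendsto (fun δ => (P δ).eval (t : ℝ)) (𝓝[>] 0) (𝓝 (Φ t)) :=
  JetIdentificationOfTarget.exists_analytic_limit

end Summit.CriticalPhenomena.CardyFormulaZ2.Theorems
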